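import Summits.CriticalPhenomena.PercolationContinuityZ3.Theorems.PercNearOneGluingNoHeavyLowerTailSahiCombTriWAndLattice3

/-!
# JOINT K-recipes for AND-products: order statistics of column atoms are unit K-vectors

Support file of the one-cut programme (crux `NoHeavyLowerTail`, stmt-CriticalPhenomena-4575; unit `prim-lf-1` gen 47, memo
`FROM-prim-lf-1-gen47-JOINT-RECIPES.md`).  Toolkit for the machine-generated certificate files of the FUNCTION-level certificate LP
(HOME/code/gen47/funcert): besides the SEPARABLE K-recipes `x ↦ p(A_x) − q(A_{xᶜ})` of `…SahiCombTriWAndLattice` (`krec_facts`), the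
certificates for intersecting blocks use JOINT recipes — monotone functions `G(w_{y₁}(x), …, w_{y_k}(x))` of several COLUMN ATOMS
`w_y(x) = kat A y yᶜ x = [x ⊔ y ∈ A] − [xᶜ ⊔ yᶜ ∈ A]` (the mechanism of the sorted profiles of `…SahiCombTriWAndMaj3`).

* `FiveUpSet.IsUnitK w` — the three unit-K-vector properties of `w : Finset γ₁ → ℤ` (values in `[-1,1]`, monotone, pair condition
  `w x + w x' ≥ 0` whenever `x ∪ x' = univ`), **`IsUnitK.sum_mul_nonneg`** — acuteness `Σ_{x∈P₁} w x · w' x ≥ 0` over an intersecting Kleitman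
  shell `P₁` (`sum_mul_nonneg_of_unit`); `isUnitK_krec` (separable recipes), `isUnitK_const_one`.
* `kat_bounds'`, `kat_mono_x`, `ind_cross_up/dn`, **`kat_cross`** — CROSS-DOMINATION: `y ∪ z = univ`, `x ∪ x' = univ` ⟹ `−w_z(x) ≤ w_y(x')`.
* **`isUnitK_pair`** — for a table `G : ℤ → ℤ → ℤ` that is monotone, `[-1,1]`-valued and TWISTED-ANTIPODAL (`G s t + G (−t) (−s) ≥ 0`) and a
  covering pair `y ∪ z = univ`, `x ↦ G (w_y x) (w_z x)` is a unit K-vector; instances `isUnitK_max₂` (`max`), `isUnitK_sgnAdd₂` (`sign (w_y + w_z)`).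
* **`isUnitK_triple`** — the same for three pairwise covering columns and a table with `G s t u + G (−min t u) (−min s u) (−min s t) ≥ 0`;
  instances `isUnitK_max₃`, `isUnitK_med₃`, `isUnitK_sgnSum₃`, `isUnitK_sgnLM₃` (`sign (ℓ+m)`), `isUnitK_sgnMM₃` (`sign (m+M)`),
  `isUnitK_layLm₃` (`[ℓ=1] − [m=−1]`), `isUnitK_laymM₃` (`[m=1] − [M=−1]`), `isUnitK_layLM₃` (`[ℓ=1] − [M=−1]`).
* `rearr₂`, and the order statistics `os₁/os₂/os₃` of three integers with `rearr₃'` (rearrangement lower bounds, pointwise `≥ 0` slack);\n* `isUnitK_kat`, `ind_sub_ind_nonneg`, `one_sub_ind_nonneg`, `ind_sub_zero_nonneg` — one-line facts for the simplest recipes of generated files.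
HONEST LABEL: complete proofs, std axioms; bookkeeping lemmas only (no statement about `TriWIneq` here). [this work]
-/

namespace Summit.CriticalPhenomena.PercolationContinuityZ3.Theorems

namespace FiveUpSet

open Finset

variable {β γ₁ : Type} [DecidableEq β] [Fintype β] [DecidableEq γ₁] [Fintype γ₁]

/-! ### Unit K-vectors -/

/-- The three unit-K-vector properties of a function on the cube `2^γ₁`: values in `[-1,1]`, monotone, and the pair condition
`0 ≤ w x + w x'` whenever `x ∪ x' = univ`. [this work] -/
structure IsUnitK (w : Finset γ₁ → ℤ) : Prop where
  val : ∀ x : Finset γ₁, -1 ≤ w x ∧ w x ≤ 1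
  mono : ∀ x x' : Finset γ₁, x ⊆ x' → w x ≤ w x'
  pair : ∀ x x' : Finset γ₁, x ∪ x' = univ → 0 ≤ w x + w x'

section acute
variable {P₁ : Finset (Finset γ₁)} (hP : IsUpperSet (P₁ : Set (Finset γ₁))) (hd : Disjoint P₁ (refl P₁))
  (hcor : ∀ U V : Finset (Finset γ₁), IsUpperSet (U : Set (Finset γ₁)) → IsUpperSet (V : Set (Finset γ₁)) → 0 ≤ corP P₁ U V)
include hP hd hcor

/-- **Acuteness**: two unit K-vectors have non-negative inner product over an intersecting Kleitman shell `P₁`. [this work] -/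
theorem IsUnitK.sum_mul_nonneg {w w' : Finset γ₁ → ℤ} (hw : IsUnitK w) (hw' : IsUnitK w') : 0 ≤ ∑ x ∈ P₁, w x * w' x :=
  sum_mul_nonneg_of_unit hP hd hcor w w' (fun x _ => by have := hw.val x; omega) (fun x _ => by have := hw'.val x; omega)
    (fun x _ x' _ h => hw.mono x x' h) (fun x _ x' _ h => hw'.mono x x' h) (fun x _ x' _ h => hw.pair x x' h) (fun x _ x' _ h => hw'.pair x x' h)

end acute

omit [Fintype γ₁] [DecidableEq γ₁] in
/-- A positive multiple does not change the sign of a sum of products (bookkeeping for scaled certificates). [this work] -/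
theorem sum_mul_nonneg_smul {P₁ : Finset (Finset γ₁)} {w w' : Finset γ₁ → ℤ} (c : ℤ) (hc : 0 ≤ c) (h : 0 ≤ ∑ x ∈ P₁, w x * w' x) :
    0 ≤ ∑ x ∈ P₁, c * (w x * w' x) := by
  rw [← mul_sum]; exact mul_nonneg hc h

/-- Separable recipes `x ↦ p(x) − q(xᶜ)` (`p, q` monotone `{0,1}`-valued, `q ≤ p`) are unit K-vectors (`krec_facts`). [this work] -/
theorem isUnitK_krec (p q : Finset γ₁ → ℤ) (hp : ∀ W, p W = 0 ∨ p W = 1) (hq : ∀ W, q W = 0 ∨ q W = 1)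
    (hpm : ∀ W W', W ⊆ W' → p W ≤ p W') (hqm : ∀ W W', W ⊆ W' → q W ≤ q W') (hqp : ∀ W, q W ≤ p W) :
    IsUnitK (fun x => p x - q xᶜ) := by
  obtain ⟨b, mo, pa⟩ := krec_facts p q hp hq hpm hqm hqp
  exact ⟨b, mo, pa⟩

/-- The constant `1` is a unit K-vector. [this work] -/
theorem isUnitK_const_one : IsUnitK (fun _ : Finset γ₁ => (1 : ℤ)) :=
  ⟨fun _ => by norm_num, fun _ _ _ => le_refl _, fun _ _ _ => by norm_num⟩

/-! ### Column atoms `w_y = kat A y yᶜ` -/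

section atoms
variable {δ : Type} [DecidableEq δ] [Fintype δ] {A : Finset (Finset (γ₁ ⊕ δ))}

omit [Fintype δ] in
/-- `kat` takes values in `[-1,1]`. [this work] -/
theorem kat_bounds' (A : Finset (Finset (γ₁ ⊕ δ))) (y y' : Finset δ) (x : Finset γ₁) : -1 ≤ kat A y y' x ∧ kat A y y' x ≤ 1 := by
  unfold kat; have := ind_nonneg_le_one A (x.disjSum y); have := ind_nonneg_le_one A (xᶜ.disjSum y'); omega

omit [Fintype δ] in
/-- `kat A y y'` is monotone in `x` for an up-set `A`. [this work] -/
theorem kat_mono_x (hA : IsUpperSet (A : Set (Finset (γ₁ ⊕ δ)))) (y y' : Finset δ) {x x' : Finset γ₁} (h : x ⊆ x') :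
    kat A y y' x ≤ kat A y y' x' := by
  unfold kat
  have h1 := ind_mono_pt hA (disjSum_mono h (le_refl y))
  have h2 := ind_mono_pt hA (disjSum_mono (compl_subset_compl.2 h) (le_refl y'))
  linarith

omit [DecidableEq β] [Fintype β] [DecidableEq γ₁] [Fintype γ₁] [DecidableEq δ] [Fintype δ] in
/-- From `x ∪ x' = univ`: `xᶜ ⊆ x'`. [this work] -/
theorem compl_subset_of_union_eq_univ {α : Type} [DecidableEq α] [Fintype α] {x x' : Finset α} (h : x ∪ x' = univ) : xᶜ ⊆ x' := by
  intro a ha; rw [mem_compl] at ha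
  have := mem_univ a; rw [← h, mem_union] at this; tauto

/-- **Cross-domination of column atoms**: if `y ∪ z = univ` and `x ∪ x' = univ` then `−w_z(x) ≤ w_y(x')`
(`[x'⊔y ∈ A] ≥ [xᶜ⊔zᶜ ∈ A]` and `[x'ᶜ⊔yᶜ ∈ A] ≤ [x⊔z ∈ A]`). [this work] -/
theorem kat_cross (hA : IsUpperSet (A : Set (Finset (γ₁ ⊕ δ)))) {y z : Finset δ} (hyz : y ∪ z = univ) {x x' : Finset γ₁}
    (hxx : x ∪ x' = univ) : -kat A z zᶜ x ≤ kat A y yᶜ x' := by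
  unfold kat
  have hc : xᶜ ⊆ x' := compl_subset_of_union_eq_univ hxx
  have hc' : x'ᶜ ⊆ x := compl_subset_of_union_eq_univ (by rw [union_comm]; exact hxx)
  have hz : zᶜ ⊆ y := compl_subset_of_union_eq_univ (by rw [union_comm]; exact hyz)
  have hy : yᶜ ⊆ z := compl_subset_of_union_eq_univ hyz
  have h1 := ind_mono_pt hA (disjSum_mono hc hz)
  have h2 := ind_mono_pt hA (disjSum_mono hc' hy)
  linarith

omit [Fintype δ] in
/-- Cross-domination of single bits (weak row to strong row): `z ⊆ y`, `x ∪ x' = univ` ⟹ `[xᶜ⊔z ∈ A] ≤ [x'⊔y ∈ A]`. [this work] -/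
theorem ind_cross_up (hA : IsUpperSet (A : Set (Finset (γ₁ ⊕ δ)))) {y z : Finset δ} (h : z ⊆ y) {x x' : Finset γ₁}
    (hxx : x ∪ x' = univ) : ind A (xᶜ.disjSum z) ≤ ind A (x'.disjSum y) :=
  ind_mono_pt hA (disjSum_mono (compl_subset_of_union_eq_univ hxx) h)

omit [Fintype δ] in
/-- Cross-domination of single bits (strong row bounds weak row): `z ⊆ y`, `x ∪ x' = univ` ⟹ `[x'ᶜ⊔z ∈ A] ≤ [x⊔y ∈ A]`. [this work] -/
theorem ind_cross_dn (hA : IsUpperSet (A : Set (Finset (γ₁ ⊕ δ)))) {y z : Finset δ} (h : z ⊆ y) {x x' : Finset γ₁}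
    (hxx : x ∪ x' = univ) : ind A (x'ᶜ.disjSum z) ≤ ind A (x.disjSum y) :=
  ind_mono_pt hA (disjSum_mono (compl_subset_of_union_eq_univ (by rw [union_comm]; exact hxx)) h)

/-! ### Pairs -/

/-- **Joint recipe of a covering pair.**  `G` monotone on `[-1,1]²`, `[-1,1]`-valued and twisted-antipodal
(`0 ≤ G s t + G (−t) (−s)`), `y ∪ z = univ` ⟹ `x ↦ G (w_y x) (w_z x)` is a unit K-vector. [this work] -/
theorem isUnitK_pair (G : ℤ → ℤ → ℤ)
    (hGm : ∀ s t s' t' : ℤ, -1 ≤ s → s' ≤ 1 → -1 ≤ t → t' ≤ 1 → s ≤ s' → t ≤ t' → G s t ≤ G s' t')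
    (hGv : ∀ s t : ℤ, -1 ≤ s → s ≤ 1 → -1 ≤ t → t ≤ 1 → -1 ≤ G s t ∧ G s t ≤ 1)
    (hGt : ∀ s t : ℤ, -1 ≤ s → s ≤ 1 → -1 ≤ t → t ≤ 1 → 0 ≤ G s t + G (-t) (-s))
    (hA : IsUpperSet (A : Set (Finset (γ₁ ⊕ δ)))) {y z : Finset δ} (hyz : y ∪ z = univ) :
    IsUnitK (fun x => G (kat A y yᶜ x) (kat A z zᶜ x)) := by
  refine ⟨fun x => ?_, fun x x' h => ?_, fun x x' h => ?_⟩
  · have b1 := kat_bounds' A y yᶜ x; have b2 := kat_bounds' A z zᶜ x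
    exact hGv _ _ b1.1 b1.2 b2.1 b2.2
  · have b1 := kat_bounds' A y yᶜ x; have b2 := kat_bounds' A z zᶜ x
    have b1' := kat_bounds' A y yᶜ x'; have b2' := kat_bounds' A z zᶜ x'
    exact hGm _ _ _ _ b1.1 b1'.2 b2.1 b2'.2 (kat_mono_x hA y yᶜ h) (kat_mono_x hA z zᶜ h)
  · have b1 := kat_bounds' A y yᶜ x; have b2 := kat_bounds' A z zᶜ x
    have b1' := kat_bounds' A y yᶜ x'; have b2' := kat_bounds' A z zᶜ x'
    have c1 := kat_cross hA hyz h
    have c2 := kat_cross hA (by rw [union_comm]; exact hyz) h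
    have step : G (-kat A z zᶜ x) (-kat A y yᶜ x) ≤ G (kat A y yᶜ x') (kat A z zᶜ x') :=
      hGm _ _ _ _ (by omega) b1'.2 (by omega) b2'.2 c1 c2
    have tw := hGt _ _ b1.1 b1.2 b2.1 b2.2
    show 0 ≤ G (kat A y yᶜ x) (kat A z zᶜ x) + G (kat A y yᶜ x') (kat A z zᶜ x')
    linarith

/-- `max` of a covering pair of column atoms is a unit K-vector. [this work] -/
theorem isUnitK_max₂ (hA : IsUpperSet (A : Set (Finset (γ₁ ⊕ δ)))) {y z : Finset δ} (hyz : y ∪ z = univ) :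
    IsUnitK (fun x => max (kat A y yᶜ x) (kat A z zᶜ x)) :=
  isUnitK_pair (fun s t => max s t) (fun s t s' t' _ _ _ _ h1 h2 => max_le_max h1 h2)
    (fun s t h1 h2 h3 h4 => by simp only [le_max_iff, max_le_iff]; omega)
    (fun s t h1 h2 h3 h4 => by simp only [max_def]; split_ifs <;> omega) hA hyz

omit [DecidableEq β] [Fintype β] [DecidableEq γ₁] [Fintype γ₁] [DecidableEq δ] [Fintype δ] in
/-- `Int.sign` takes values in `[-1,1]`. [this work] -/
theorem sign_bounds' (a : ℤ) : -1 ≤ Int.sign a ∧ Int.sign a ≤ 1 := by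
  rcases lt_trichotomy a 0 with ha | rfl | ha
  · rw [Int.sign_eq_neg_one_of_neg ha]; norm_num
  · rw [Int.sign_zero]; norm_num
  · rw [Int.sign_eq_one_of_pos ha]; norm_num

omit [DecidableEq β] [Fintype β] [DecidableEq γ₁] [Fintype γ₁] [DecidableEq δ] [Fintype δ] in
/-- `Int.sign` is monotone. [this work] -/
theorem sign_mono' {a b : ℤ} (h : a ≤ b) : Int.sign a ≤ Int.sign b := by
  rcases lt_trichotomy a 0 with ha | rfl | ha
  · rw [Int.sign_eq_neg_one_of_neg ha]; exact (sign_bounds' b).1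
  · rw [Int.sign_zero]
    rcases lt_trichotomy b 0 with hb | rfl | hb
    · omega
    · rw [Int.sign_zero]
    · rw [Int.sign_eq_one_of_pos hb]; norm_num
  · rw [Int.sign_eq_one_of_pos ha, Int.sign_eq_one_of_pos (lt_of_lt_of_le ha h)]

/-- `sign (w_y + w_z)` of a covering pair is a unit K-vector. [this work] -/
theorem isUnitK_sgnAdd₂ (hA : IsUpperSet (A : Set (Finset (γ₁ ⊕ δ)))) {y z : Finset δ} (hyz : y ∪ z = univ) :
    IsUnitK (fun x => Int.sign (kat A y yᶜ x + kat A z zᶜ x)) :=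
  isUnitK_pair (fun s t => Int.sign (s + t)) (fun s t s' t' _ _ _ _ h1 h2 => sign_mono' (by omega))
    (fun s t _ _ _ _ => sign_bounds' _)
    (fun s t _ _ _ _ => by
      have : -t + -s = -(s + t) := by ring
      rw [this, Int.sign_neg]; omega) hA hyz

/-! ### Triples -/

/-- **Joint recipe of a pairwise covering triple.**  `G` monotone, `[-1,1]`-valued and twisted-antipodal in the form
`0 ≤ G s t u + G (−min t u) (−min s u) (−min s t)`; `y_i ∪ y_j = univ` for `i ≠ j` ⟹ `x ↦ G (w₁ x) (w₂ x) (w₃ x)` is a unit K-vector. [this work] -/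
theorem isUnitK_triple (G : ℤ → ℤ → ℤ → ℤ)
    (hGm : ∀ s t u s' t' u' : ℤ, -1 ≤ s → s' ≤ 1 → -1 ≤ t → t' ≤ 1 → -1 ≤ u → u' ≤ 1 → s ≤ s' → t ≤ t' → u ≤ u' → G s t u ≤ G s' t' u')
    (hGv : ∀ s t u : ℤ, -1 ≤ s → s ≤ 1 → -1 ≤ t → t ≤ 1 → -1 ≤ u → u ≤ 1 → -1 ≤ G s t u ∧ G s t u ≤ 1)
    (hGt : ∀ s t u : ℤ, -1 ≤ s → s ≤ 1 → -1 ≤ t → t ≤ 1 → -1 ≤ u → u ≤ 1 → 0 ≤ G s t u + G (-min t u) (-min s u) (-min s t))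
    (hA : IsUpperSet (A : Set (Finset (γ₁ ⊕ δ)))) {y₁ y₂ y₃ : Finset δ} (h12 : y₁ ∪ y₂ = univ) (h13 : y₁ ∪ y₃ = univ)
    (h23 : y₂ ∪ y₃ = univ) :
    IsUnitK (fun x => G (kat A y₁ y₁ᶜ x) (kat A y₂ y₂ᶜ x) (kat A y₃ y₃ᶜ x)) := by
  refine ⟨fun x => ?_, fun x x' h => ?_, fun x x' h => ?_⟩
  · have b1 := kat_bounds' A y₁ y₁ᶜ x; have b2 := kat_bounds' A y₂ y₂ᶜ x; have b3 := kat_bounds' A y₃ y₃ᶜ x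
    exact hGv _ _ _ b1.1 b1.2 b2.1 b2.2 b3.1 b3.2
  · have b1 := kat_bounds' A y₁ y₁ᶜ x; have b2 := kat_bounds' A y₂ y₂ᶜ x; have b3 := kat_bounds' A y₃ y₃ᶜ x
    have b1' := kat_bounds' A y₁ y₁ᶜ x'; have b2' := kat_bounds' A y₂ y₂ᶜ x'; have b3' := kat_bounds' A y₃ y₃ᶜ x'
    exact hGm _ _ _ _ _ _ b1.1 b1'.2 b2.1 b2'.2 b3.1 b3'.2 (kat_mono_x hA _ _ h) (kat_mono_x hA _ _ h) (kat_mono_x hA _ _ h)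
  · have b1 := kat_bounds' A y₁ y₁ᶜ x; have b2 := kat_bounds' A y₂ y₂ᶜ x; have b3 := kat_bounds' A y₃ y₃ᶜ x
    have b1' := kat_bounds' A y₁ y₁ᶜ x'; have b2' := kat_bounds' A y₂ y₂ᶜ x'; have b3' := kat_bounds' A y₃ y₃ᶜ x'
    have c12 := kat_cross hA h12 h; have c13 := kat_cross hA h13 h; have c23 := kat_cross hA h23 h
    have c21 := kat_cross hA (by rw [union_comm]; exact h12) h
    have c31 := kat_cross hA (by rw [union_comm]; exact h13) h
    have c32 := kat_cross hA (by rw [union_comm]; exact h23) h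
    -- w₁(x') ≥ -min(w₂ x, w₃ x), etc.
    have m1 : -min (kat A y₂ y₂ᶜ x) (kat A y₃ y₃ᶜ x) ≤ kat A y₁ y₁ᶜ x' := by simp only [min_def]; split_ifs <;> omega
    have m2 : -min (kat A y₁ y₁ᶜ x) (kat A y₃ y₃ᶜ x) ≤ kat A y₂ y₂ᶜ x' := by simp only [min_def]; split_ifs <;> omega
    have m3 : -min (kat A y₁ y₁ᶜ x) (kat A y₂ y₂ᶜ x) ≤ kat A y₃ y₃ᶜ x' := by simp only [min_def]; split_ifs <;> omega
    have step : G (-min (kat A y₂ y₂ᶜ x) (kat A y₃ y₃ᶜ x)) (-min (kat A y₁ y₁ᶜ x) (kat A y₃ y₃ᶜ x)) (-min (kat A y₁ y₁ᶜ x) (kat A y₂ y₂ᶜ x))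
        ≤ G (kat A y₁ y₁ᶜ x') (kat A y₂ y₂ᶜ x') (kat A y₃ y₃ᶜ x') :=
      hGm _ _ _ _ _ _ (by simp only [min_def]; split_ifs <;> omega) b1'.2 (by simp only [min_def]; split_ifs <;> omega) b2'.2
        (by simp only [min_def]; split_ifs <;> omega) b3'.2 m1 m2 m3
    have tw := hGt _ _ _ b1.1 b1.2 b2.1 b2.2 b3.1 b3.2
    show 0 ≤ G (kat A y₁ y₁ᶜ x) (kat A y₂ y₂ᶜ x) (kat A y₃ y₃ᶜ x) + G (kat A y₁ y₁ᶜ x') (kat A y₂ y₂ᶜ x') (kat A y₃ y₃ᶜ x')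
    linarith

end atoms

/-! ### Order statistics of three values and the named tables -/

/-- Largest of three. [this work] -/
def os₁ (s t u : ℤ) : ℤ := max (max s t) u
/-- Median of three. [this work] -/
def os₂ (s t u : ℤ) : ℤ := max (min s t) (min (max s t) u)
/-- Smallest of three. [this work] -/
def os₃ (s t u : ℤ) : ℤ := min (min s t) u
/-- `sign (ℓ + m)` (two smallest). [this work] -/
def sgnLM₃ (s t u : ℤ) : ℤ := Int.sign (os₂ s t u + os₃ s t u)
/-- `sign (m + M)` (two largest). [this work] -/
def sgnMM₃ (s t u : ℤ) : ℤ := Int.sign (os₁ s t u + os₂ s t u)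
/-- `sign (s + t + u)`. [this work] -/
def sgnSum₃ (s t u : ℤ) : ℤ := Int.sign (s + t + u)
/-- The layer `[ℓ = 1] − [m = −1]`. [this work] -/
def layLm₃ (s t u : ℤ) : ℤ := (if os₃ s t u = 1 then 1 else 0) - (if os₂ s t u = -1 then 1 else 0)
/-- The layer `[m = 1] − [M = −1]`. [this work] -/
def laymM₃ (s t u : ℤ) : ℤ := (if os₂ s t u = 1 then 1 else 0) - (if os₁ s t u = -1 then 1 else 0)
/-- The layer `[ℓ = 1] − [M = −1]`. [this work] -/
def layLM₃ (s t u : ℤ) : ℤ := (if os₃ s t u = 1 then 1 else 0) - (if os₁ s t u = -1 then 1 else 0)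

/-- `os₁ + os₂ + os₃ = s + t + u`. [this work] -/
theorem os_sum (s t u : ℤ) : os₁ s t u + os₂ s t u + os₃ s t u = s + t + u := by
  unfold os₁ os₂ os₃; simp only [max_def, min_def]; split_ifs <;> omega

/-- Rearrangement for two values in `[-1,1]` is not needed in bounded form: `max a b · min a' b' + min a b · max a' b' ≤ a a' + b b'`. [this work] -/
theorem rearr₂ (a b a' b' : ℤ) : max a b * min a' b' + min a b * max a' b' ≤ a * a' + b * b' := by
  rcases le_total a b with h | h <;> rcases le_total a' b' with h' | h'
  · rw [max_eq_right h, min_eq_left h, min_eq_left h', max_eq_right h']; nlinarith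
  · rw [max_eq_right h, min_eq_left h, min_eq_right h', max_eq_left h']; nlinarith
  · rw [max_eq_left h, min_eq_right h, min_eq_left h', max_eq_right h']
  · rw [max_eq_left h, min_eq_right h, min_eq_right h', max_eq_left h']; nlinarith

/-- Rearrangement for three values in `[-1,1]` (order statistics form of `rearr3`):
`os₁·os₃' + os₂·os₂' + os₃·os₁' ≤ s s' + t t' + u u'`. [this work] -/
theorem rearr₃' (s t u s' t' u' : ℤ) (h1 : -1 ≤ s) (h1' : s ≤ 1) (h2 : -1 ≤ t) (h2' : t ≤ 1) (h3 : -1 ≤ u) (h3' : u ≤ 1) :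
    os₁ s t u * os₃ s' t' u' + os₂ s t u * os₂ s' t' u' + os₃ s t u * os₁ s' t' u' ≤ s * s' + t * t' + u * u' := by
  have h := rearr3 s t u s' t' u' h1 h1' h2 h2' h3 h3'
  have e1 : os₂ s t u = s + t + u - os₃ s t u - os₁ s t u := by linarith [os_sum s t u]
  have e2 : os₂ s' t' u' = s' + t' + u' - os₃ s' t' u' - os₁ s' t' u' := by linarith [os_sum s' t' u']
  unfold os₁ os₃ at e1 e2 ⊢
  rw [e1, e2]; linarith

/-- Bounds of the order statistics. [this work] -/
theorem os_bounds {s t u : ℤ} (h1 : -1 ≤ s) (h1' : s ≤ 1) (h2 : -1 ≤ t) (h2' : t ≤ 1) (h3 : -1 ≤ u) (h3' : u ≤ 1) :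
    (-1 ≤ os₁ s t u ∧ os₁ s t u ≤ 1) ∧ (-1 ≤ os₂ s t u ∧ os₂ s t u ≤ 1) ∧ (-1 ≤ os₃ s t u ∧ os₃ s t u ≤ 1) := by
  unfold os₁ os₂ os₃; simp only [max_def, min_def]; split_ifs <;> omega

/-- `os₁` is monotone. [this work] -/
theorem os₁_mono {s t u s' t' u' : ℤ} (h1 : s ≤ s') (h2 : t ≤ t') (h3 : u ≤ u') : os₁ s t u ≤ os₁ s' t' u' :=
  max_le_max (max_le_max h1 h2) h3
/-- `os₂` is monotone. [this work] -/
theorem os₂_mono {s t u s' t' u' : ℤ} (h1 : s ≤ s') (h2 : t ≤ t') (h3 : u ≤ u') : os₂ s t u ≤ os₂ s' t' u' :=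
  max_le_max (min_le_min h1 h2) (min_le_min (max_le_max h1 h2) h3)
/-- `os₃` is monotone. [this work] -/
theorem os₃_mono {s t u s' t' u' : ℤ} (h1 : s ≤ s') (h2 : t ≤ t') (h3 : u ≤ u') : os₃ s t u ≤ os₃ s' t' u' :=
  min_le_min (min_le_min h1 h2) h3

section triples
variable {δ : Type} [DecidableEq δ] [Fintype δ] {A : Finset (Finset (γ₁ ⊕ δ))} (hA : IsUpperSet (A : Set (Finset (γ₁ ⊕ δ))))
  {y₁ y₂ y₃ : Finset δ} (h12 : y₁ ∪ y₂ = univ) (h13 : y₁ ∪ y₃ = univ) (h23 : y₂ ∪ y₃ = univ)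
include hA h12 h13 h23

/-- `os₁` (max) of a pairwise covering triple is a unit K-vector. [this work] -/
theorem isUnitK_max₃ : IsUnitK (fun x => os₁ (kat A y₁ y₁ᶜ x) (kat A y₂ y₂ᶜ x) (kat A y₃ y₃ᶜ x)) :=
  isUnitK_triple os₁ (fun _ _ _ _ _ _ _ _ _ _ _ _ a b c => os₁_mono a b c) (fun _ _ _ a b c d e f => (os_bounds a b c d e f).1)
    (fun s t u a b c d e f => by
      interval_cases s <;> interval_cases t <;> interval_cases u <;> decide) hA h12 h13 h23

/-- `os₂` (median) of a pairwise covering triple is a unit K-vector. [this work] -/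
theorem isUnitK_med₃ : IsUnitK (fun x => os₂ (kat A y₁ y₁ᶜ x) (kat A y₂ y₂ᶜ x) (kat A y₃ y₃ᶜ x)) :=
  isUnitK_triple os₂ (fun _ _ _ _ _ _ _ _ _ _ _ _ a b c => os₂_mono a b c) (fun _ _ _ a b c d e f => (os_bounds a b c d e f).2.1)
    (fun s t u a b c d e f => by
      interval_cases s <;> interval_cases t <;> interval_cases u <;> decide) hA h12 h13 h23

/-- `sign (s+t+u)` of a pairwise covering triple is a unit K-vector. [this work] -/
theorem isUnitK_sgnSum₃ : IsUnitK (fun x => sgnSum₃ (kat A y₁ y₁ᶜ x) (kat A y₂ y₂ᶜ x) (kat A y₃ y₃ᶜ x)) :=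
  isUnitK_triple sgnSum₃ (fun _ _ _ _ _ _ _ _ _ _ _ _ a b c => sign_mono' (by omega)) (fun _ _ _ _ _ _ _ _ _ => sign_bounds' _)
    (fun s t u a b c d e f => by
      interval_cases s <;> interval_cases t <;> interval_cases u <;> decide) hA h12 h13 h23

/-- `sign (ℓ + m)` of a pairwise covering triple is a unit K-vector. [this work] -/
theorem isUnitK_sgnLM₃ : IsUnitK (fun x => sgnLM₃ (kat A y₁ y₁ᶜ x) (kat A y₂ y₂ᶜ x) (kat A y₃ y₃ᶜ x)) :=
  isUnitK_triple sgnLM₃ (fun _ _ _ _ _ _ _ _ _ _ _ _ a b c => sign_mono' (add_le_add (os₂_mono a b c) (os₃_mono a b c)))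
    (fun _ _ _ _ _ _ _ _ _ => sign_bounds' _)
    (fun s t u a b c d e f => by
      interval_cases s <;> interval_cases t <;> interval_cases u <;> decide) hA h12 h13 h23

/-- `sign (m + M)` of a pairwise covering triple is a unit K-vector. [this work] -/
theorem isUnitK_sgnMM₃ : IsUnitK (fun x => sgnMM₃ (kat A y₁ y₁ᶜ x) (kat A y₂ y₂ᶜ x) (kat A y₃ y₃ᶜ x)) :=
  isUnitK_triple sgnMM₃ (fun _ _ _ _ _ _ _ _ _ _ _ _ a b c => sign_mono' (add_le_add (os₁_mono a b c) (os₂_mono a b c)))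
    (fun _ _ _ _ _ _ _ _ _ => sign_bounds' _)
    (fun s t u a b c d e f => by
      interval_cases s <;> interval_cases t <;> interval_cases u <;> decide) hA h12 h13 h23

/-- `[ℓ = 1] − [m = −1]` of a pairwise covering triple is a unit K-vector. [this work] -/
theorem isUnitK_layLm₃ : IsUnitK (fun x => layLm₃ (kat A y₁ y₁ᶜ x) (kat A y₂ y₂ᶜ x) (kat A y₃ y₃ᶜ x)) :=
  isUnitK_triple layLm₃
    (fun s t u s' t' u' a1 a2 b1 b2 c1 c2 a b c => by
      have m3 := os₃_mono a b c; have m2 := os₂_mono a b c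
      have bo := os_bounds a1 (by omega) b1 (by omega) c1 (by omega)
      have bo' := os_bounds (s := s') (t := t') (u := u') (by omega) a2 (by omega) b2 (by omega) c2
      unfold layLm₃; split_ifs <;> omega)
    (fun s t u a b c d e f => by unfold layLm₃; split_ifs <;> omega)
    (fun s t u a b c d e f => by
      interval_cases s <;> interval_cases t <;> interval_cases u <;> decide) hA h12 h13 h23

/-- `[m = 1] − [M = −1]` of a pairwise covering triple is a unit K-vector. [this work] -/
theorem isUnitK_laymM₃ : IsUnitK (fun x => laymM₃ (kat A y₁ y₁ᶜ x) (kat A y₂ y₂ᶜ x) (kat A y₃ y₃ᶜ x)) :=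
  isUnitK_triple laymM₃
    (fun s t u s' t' u' a1 a2 b1 b2 c1 c2 a b c => by
      have m1 := os₁_mono a b c; have m2 := os₂_mono a b c
      have bo := os_bounds a1 (by omega) b1 (by omega) c1 (by omega)
      have bo' := os_bounds (s := s') (t := t') (u := u') (by omega) a2 (by omega) b2 (by omega) c2
      unfold laymM₃; split_ifs <;> omega)
    (fun s t u a b c d e f => by unfold laymM₃; split_ifs <;> omega)
    (fun s t u a b c d e f => by
      interval_cases s <;> interval_cases t <;> interval_cases u <;> decide) hA h12 h13 h23

/-- `[ℓ = 1] − [M = −1]` of a pairwise covering triple is a unit K-vector. [this work] -/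
theorem isUnitK_layLM₃ : IsUnitK (fun x => layLM₃ (kat A y₁ y₁ᶜ x) (kat A y₂ y₂ᶜ x) (kat A y₃ y₃ᶜ x)) :=
  isUnitK_triple layLM₃
    (fun s t u s' t' u' a1 a2 b1 b2 c1 c2 a b c => by
      have m1 := os₁_mono a b c; have m3 := os₃_mono a b c
      have bo := os_bounds a1 (by omega) b1 (by omega) c1 (by omega)
      have bo' := os_bounds (s := s') (t := t') (u := u') (by omega) a2 (by omega) b2 (by omega) c2
      unfold layLM₃; split_ifs <;> omega)
    (fun s t u a b c d e f => by unfold layLM₃; split_ifs <;> omega)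
    (fun s t u a b c d e f => by
      interval_cases s <;> interval_cases t <;> interval_cases u <;> decide) hA h12 h13 h23

end triples

/-! ### One-line facts for the simplest recipes (used by the generated certificate files) -/

section simple
variable {δ : Type} [DecidableEq δ] [Fintype δ] {A : Finset (Finset (γ₁ ⊕ δ))} (hA : IsUpperSet (A : Set (Finset (γ₁ ⊕ δ))))
include hA

omit [Fintype δ] in
/-- The unit atom `kat A y y' = [x⊔y ∈ A] − [xᶜ⊔y' ∈ A]` with `y' ⊆ y` is a unit K-vector. [this work] -/
theorem isUnitK_kat {y y' : Finset δ} (h : y' ⊆ y) : IsUnitK (kat A y y') :=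
  isUnitK_krec (fun W => ind A (W.disjSum y)) (fun W => ind A (W.disjSum y')) (fun _ => ind_eq_zero_or_one A _)
    (fun _ => ind_eq_zero_or_one A _) (fun _ _ hW => ind_mono_pt hA (disjSum_mono hW (le_refl _)))
    (fun _ _ hW => ind_mono_pt hA (disjSum_mono hW (le_refl _))) (fun W => ind_mono_pt hA (disjSum_mono (le_refl W) h))

omit [Fintype δ] [Fintype γ₁] in
/-- A difference of two indicator bits at nested points of one row is `≥ 0`: `y' ⊆ y` ⟹ `0 ≤ [W⊔y ∈ A] − [W⊔y' ∈ A]`. [this work] -/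
theorem ind_sub_ind_nonneg {y y' : Finset δ} (h : y' ⊆ y) (W : Finset γ₁) : 0 ≤ ind A (W.disjSum y) - ind A (W.disjSum y') :=
  sub_nonneg.2 (ind_mono_pt hA (disjSum_mono (le_refl W) h))

omit hA [Fintype δ] [Fintype γ₁] in
/-- `0 ≤ 1 − [t ∈ A]`. [this work] -/
theorem one_sub_ind_nonneg (t : Finset (γ₁ ⊕ δ)) : 0 ≤ 1 - ind A t := by
  have := ind_nonneg_le_one A t; omega

omit hA [Fintype δ] [Fintype γ₁] in
/-- `0 ≤ [t ∈ A]` (restated with the subtraction shape `[t∈A] − 0` used by generated files). [this work] -/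
theorem ind_sub_zero_nonneg (t : Finset (γ₁ ⊕ δ)) : 0 ≤ ind A t - 0 := by
  have := ind_nonneg_le_one A t; omega

end simple

end FiveUpSet

end Summit.CriticalPhenomena.PercolationContinuityZ3.Theorems
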